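import Summits.AtomisticToContinuum.Crystallization.Theorems.FrustratedLawDichotomyCellTEQ15Data

/-!
# FrustratedLawDichotomy · crux `AperiodicFrustratedLawGap` (stmt-AtomisticToContinuum-27623) — TEQ15 witness cell: geometry, all-bad classes, total, parameters
# (decomp-a2c, prover hand 2, generation 17; each theorem ONE `decide +kernel`, split for the farm's per-declaration budget). [folklore]
-/

namespace Summit.AtomisticToContinuum.Crystallization.Theorems.FrustratedLawDichotomyCellTEQ15

open scoped BigOperators
open Summit.AtomisticToContinuum.Crystallization.Theorems.FrustratedLawDichotomyCellChecker
open Summit.AtomisticToContinuum.Crystallization.Theorems.FrustratedLawDichotomyCellKitX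

set_option maxHeartbeats 0 in
/-- The geometry of `cellTEQ15` passes `checkGeom`. [folklore] -/
theorem teq15_checkGeom : cellTEQ15.checkGeom = true := by decide +kernel

set_option maxHeartbeats 0 in
/-- Class `0` passes `checkClassBad` (nn/far witnesses, pinning scan, site-sum bound). [folklore] -/
theorem teq15_checkClass0 : cellTEQ15.checkClassBad ⟨0, by decide⟩ (cellTEQ15Cert 0) = true := by decide +kernel

set_option maxHeartbeats 0 in
/-- Class `1` passes `checkClassBad`. [folklore] -/
theorem teq15_checkClass1 : cellTEQ15.checkClassBad ⟨1, by decide⟩ (cellTEQ15Cert 1) = true := by decide +kernel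

/-- Both classes pass `checkClassBad`. [folklore] -/
theorem teq15_checkClass : ∀ m : Fin cellTEQ15.N₀, cellTEQ15.checkClassBad m (cellTEQ15Cert m) = true := by
  intro m
  obtain ⟨m, hm⟩ := m
  have hm' : m < 2 := hm
  interval_cases m
  exacts [teq15_checkClass0, teq15_checkClass1]

set_option maxHeartbeats 0 in
/-- The certified mean priced site energy lies below `−0.7175 + 1/100` (margin `7·10⁻⁵` per site). [folklore] -/
theorem teq15_total : ((∑ m : Fin 2, (((cellTEQ15Cert m).Ub + 3 / 200) / 2 - 3 / 400)) : ℚ) < 2 * (-(7175 / 10000) + 1 / 100) := by decide +kernel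

set_option maxHeartbeats 0 in
/-- The exemption parameters of record pass `checkParams` (`cB·(7 + Dq) < k₀ + 1`). [folklore] -/
theorem teq15_checkParams : checkParams cellTEQ15 cellTEQ15P = true := by decide +kernel

end Summit.AtomisticToContinuum.Crystallization.Theorems.FrustratedLawDichotomyCellTEQ15
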